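import Summits.BirchSwinnertonDyer.Rank1Residual.Additive.SignedTwistPlusSelmerInfty
import Summits.BirchSwinnertonDyer.Rank1Residual.Additive.SignedTwistDualTransport
import HarnessLib

/-!
# The dual transport of the signed-`η` twist FOR ANY SIGN with a Selmer dictionary, as an EXISTENCE
# theorem (no definition), and the PLUS instance: every Pontryagin-dual datum of `Sel⁺(W/ℚ_∞)` IS an
# `η`-signed dual datum of `V` over `K₀ℚ_∞` with the same finiteness, torsion, characteristic ideal
# and finite submodules (cell `bsd-potss`, seat `bsd-potss-ctrl` g2; fifth brick of T-e2-R1⁺ = the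
# plus twin of x1b's P5-5a `SignedTwistDualTransport` (D5); TARGET.md v6 §0.12 (e))

HONEST FRAMING (cell `bsd-potss`, run/shared/lean/pub/bsd-potss/; FULL-BSD rank ≤ 1 programme,
tranche 1b): TOOL THEOREMS ONLY — NO definition (x1b's (D5) is a `def … toEtaSigned`; here the
re-indexed datum is an anonymous witness of an `∃`, carrying exactly the four properties the readings
consume), no named Literature fact, no Summits-side fact `def … : Prop`, no `sorry`, axioms standard;
nothing is booked; no label / mark / count moves; nothing about (C1_η) or `BSD(W, p)` is claimed.

## What
* `conjH1_eq_eta_smul_conjH1_of_mem_etaSigned` — `conj_{γ'} = η(γ)·conj_γ` on `Sel^ε(V/K₀ℚ_∞)^η`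
  for `γ' ∈ Gal(ℚ̄/K₀)`, `γ⁻¹γ' ∈ ker κ` (x1b's lemma, any sign).
* `exists_etaSignedSelmerDualData_of_map_eq` — ANY SIGN `ε`, under the HYPOTHESIS (D3) at `ε`
  (`Θ_∞ (Sel^{ε,str}(W/ℚ_∞)) = Sel^ε(V/K₀ℚ_∞)^η`, a plain equation): for every
  `D : StrictSignedSelmerDualData W κ E γ ε` there is `D' : EtaSignedSelmerDualData V κ K₀ E η γ' ε`
  with `Module.Finite D'.X ↔ Module.Finite D.X`, `IsTorsion D'.X ↔ IsTorsion D.X`,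
  `D'.charIdeal = D.charIdeal`, and the same "no non-zero finite submodule" property — the witness
  has the SAME module `D.X`, its character group re-indexed along `Θ_∞` (x1b's (D5) construction
  verbatim: `T = γ − 1 ↦ T = γ' − 1` because `conj_{γ'} = η(γ)·conj_γ` on the `η`-component matches
  `Θ_∞ ∘ conj_γ = η(γ)·conj_γ ∘ Θ_∞`; constants through `ℤ_p → ℤ/pᵏ` as before).
* **`exists_etaSignedSelmerDualData_one`** — THE PLUS INSTANCE ((D3⁺) of brick 4 discharges the
  hypothesis): `X⁺_W(ℚ_∞)` IS `X⁺(V/K₀ℚ_∞)^η` for the purposes of every reading.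

References: [Kobayashi2003] Def. 2.1 (p. 5), §3 p. 5 (`γ ↔ 1 + X`), §4 p. 8 (`X^±(E/K_∞)^η`);
[GreenbergLNM1716] §1 p. 60.
-/

noncomputable section

open scoped Classical

open WeierstrassCurve Field

namespace Summit.BirchSwinnertonDyer.Rank1Residual.Additive.SignedTwist

open Literature.NumberTheory.EllipticCurves Literature.NumberTheory.GaloisRepresentations
  Literature.NumberTheory.EllipticCurves.Kobayashi2003
  Summit.BirchSwinnertonDyer.Rank1Residual.AdditivePotMult ZpExtension

variable (W : WeierstrassCurve ℚ) (K₀ : Type) [Field K₀] [NumberField K₀] {θ : K₀} {c : ℚ}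
  (hθ : θ ∉ Set.range (algebraMap ℚ K₀)) (hc : θ ^ 2 = algebraMap ℚ K₀ c)
  (p : ℕ) [Fact p.Prime] (κ : ZpExtension ℚ p)
  {V : WeierstrassCurve ℚ} {C : VariableChange ℚ} (hCV : C • W.quadraticTwist c = V)
  (η : absoluteGaloisGroup ℚ →* ℤˣ)
  (hη : ∀ σ : absoluteGaloisGroup ℚ, η σ = 1 ↔ σ • rootInClosure K₀ θ = rootInClosure K₀ θ)
  (E : Type) [Field E] [Algebra ℚ E] [(galRange (K := ℚ) K₀).Normal]

include hη in
/-- **`conj_{γ'} = η(γ) · conj_γ` on the `η`-component**, any sign: for `γ' ∈ Gal(ℚ̄/K₀)` with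
`γ⁻¹γ' ∈ ker κ` and `t ∈ Sel^ε(V/K₀ℚ_∞)^η`. [cite: Kobayashi2003, §4 p. 8 (M^η = ε_η M), §3 p. 5] -/
theorem conjH1_eq_eta_smul_conjH1_of_mem_etaSigned (ε : ℤˣ) {γ γ' : absoluteGaloisGroup ℚ}
    (hγ' : γ' ∈ galRange (K := ℚ) K₀) (hγγ' : γ⁻¹ * γ' ∈ κ.kerSubgroup)
    {t : V.subgroupH1 p (towerTopSubgroup κ K₀)} (ht : t ∈ towerSignedSelmerInftyEta V κ K₀ E η ε) :
    V.conjH1 p (towerTopSubgroup κ K₀) γ' t =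
      ((η γ : ℤˣ) : ℤ) • V.conjH1 p (towerTopSubgroup κ K₀) γ t := by
  have hηγ' : η γ' = 1 := (hη γ').mpr (apply_rootInClosure_of_mem K₀ hγ')
  have hη2 : η (γ⁻¹ * γ') = η γ := by
    rw [map_mul, map_inv, hηγ', mul_one, Int.units_inv_eq_self]
  have h1 : γ' = γ * (γ⁻¹ * γ') := (mul_inv_cancel_left γ γ').symm
  conv_lhs => rw [h1]
  rw [V.conjH1_mul_holds p (towerTopSubgroup κ K₀) γ (γ⁻¹ * γ'), AddMonoidHom.comp_apply,
    ht.2 _ hγγ', map_zsmul, hη2]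

include hη in
/-- **(D5) as an existence theorem, any sign with a Selmer dictionary**: under (D3) at `ε`, every
Pontryagin-dual datum `D` of `Sel^{ε,str}(W/ℚ_∞)` at `γ` yields an `η`-signed dual datum of `V` over
`K₀ℚ_∞` at `γ'` (`γ' ∈ Gal(ℚ̄/K₀)`, `γ⁻¹γ' ∈ ker κ`) with the SAME module — hence the same
finiteness, torsion, characteristic ideal and finite submodules. x1b's (D5) construction verbatim on
an abstract isomorphism `Φ` with `Φ s = Θ_∞ s`.
[cite: Kobayashi2003, Def. 2.1 (p. 5), §3 p. 5, §4 p. 8] [cite: GreenbergLNM1716, §1 (p. 60)] -/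
theorem exists_etaSignedSelmerDualData_of_map_eq (ε : ℤˣ)
    (hcop : (galRange (K := ℚ) K₀).index.Coprime p)
    (hD3 : (strictSignedSelmerInfty W κ E ε).map (h1TransportInfty W K₀ hθ hc p κ hCV) =
      towerSignedSelmerInftyEta V κ K₀ E η ε)
    {γ γ' : absoluteGaloisGroup ℚ} (hγ' : γ' ∈ galRange (K := ℚ) K₀)
    (hγγ' : γ⁻¹ * γ' ∈ κ.kerSubgroup) (D : StrictSignedSelmerDualData W κ E γ ε) :
    ∃ D' : EtaSignedSelmerDualData V κ K₀ E η γ' ε,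
      (Module.Finite (IwasawaAlgebra p) D'.X ↔ Module.Finite (IwasawaAlgebra p) D.X) ∧
      (Module.IsTorsion (IwasawaAlgebra p) D'.X ↔ Module.IsTorsion (IwasawaAlgebra p) D.X) ∧
      D'.charIdeal = D.charIdeal ∧
      ((∀ M : Submodule (IwasawaAlgebra p) D'.X, Finite M → M = ⊥) ↔
        (∀ M : Submodule (IwasawaAlgebra p) D.X, Finite M → M = ⊥)) := by
  -- the Selmer-level isomorphism `Φ = Θ_∞`
  obtain ⟨Φ, hΦ⟩ : ∃ Φ : strictSignedSelmerInfty W κ E ε ≃+ towerSignedSelmerInftyEta V κ K₀ E η ε,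
      ∀ s, ((Φ s : towerSignedSelmerInftyEta V κ K₀ E η ε) : V.subgroupH1 p (towerTopSubgroup κ K₀)) =
        h1TransportInfty W K₀ hθ hc p κ hCV s :=
    ⟨((strictSignedSelmerInfty W κ E ε).equivMapOfInjective (h1TransportInfty W K₀ hθ hc p κ hCV)
        (h1TransportInfty_injective W K₀ hθ hc p κ hCV hcop)).trans (AddEquiv.addSubgroupCongr hD3),
      fun _ ↦ rfl⟩
  -- Galois bookkeeping: `Φ (conj_γ s) = conj_{γ'} (Φ s)`
  have hconj : ∀ s : strictSignedSelmerInfty W κ E ε,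
      Φ ⟨W.conjH1 p κ.kerSubgroup γ s, conjH1_mem_strictSignedSelmerInfty W κ E ε γ s.2⟩ =
        ⟨V.conjH1 p (towerTopSubgroup κ K₀) γ' (Φ s : V.subgroupH1 p (towerTopSubgroup κ K₀)),
          conjH1_mem_towerSignedSelmerInftyEta V κ K₀ E η ε γ' (Φ s).2⟩ := by
    intro s
    apply Subtype.ext
    rw [hΦ, h1TransportInfty_conjH1 W K₀ hθ hc p κ hCV η hη γ s, ← hΦ]
    exact (conjH1_eq_eta_smul_conjH1_of_mem_etaSigned K₀ p κ η hη E ε hγ' hγγ' (Φ s).2).symm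
  refine ⟨{ X := D.X
            addCommGroup := D.addCommGroup
            module := D.module
            conj_mem := fun _ hs ↦ conjH1_mem_towerSignedSelmerInftyEta V κ K₀ E η ε γ' hs
            toDual := AddMonoidHom.mk' (fun x ↦ (D.toDual x).comp
                (Φ.symm : towerSignedSelmerInftyEta V κ K₀ E η ε →+ strictSignedSelmerInfty W κ E ε))
              (fun x y ↦ by rw [map_add, AddMonoidHom.add_comp])
            bijective := ?_
            toDual_T_smul := ?_
            toDual_C_smul := ?_ }, Iff.rfl, Iff.rfl, rfl, Iff.rfl⟩
  · constructor
    · intro x y hxy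
      apply D.bijective.1
      ext s
      have h := DFunLike.congr_fun hxy (Φ s)
      change D.toDual x (Φ.symm (Φ s)) = D.toDual y (Φ.symm (Φ s)) at h
      rwa [AddEquiv.symm_apply_apply] at h
    · intro φ
      obtain ⟨x, hx⟩ := D.bijective.2 (φ.comp
        (Φ : strictSignedSelmerInfty W κ E ε →+ towerSignedSelmerInftyEta V κ K₀ E η ε))
      refine ⟨x, ?_⟩
      ext t
      change D.toDual x (Φ.symm t) = φ t
      rw [hx, AddMonoidHom.comp_apply, AddMonoidHom.coe_coe, AddEquiv.apply_symm_apply]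
  · intro x s
    change D.toDual (PowerSeries.X • x) (Φ.symm s) =
      D.toDual x (Φ.symm ⟨V.conjH1 p (towerTopSubgroup κ K₀) γ' s, _⟩) - D.toDual x (Φ.symm s)
    rw [D.toDual_T_smul x _]
    congr 2
    rw [eq_comm, AddEquiv.symm_apply_eq, hconj]
    simp_rw [AddEquiv.apply_symm_apply]
  · intro c' x s k hk
    change D.toDual (PowerSeries.C c' • x) (Φ.symm s) = (PadicInt.toZModPow k c').val • D.toDual x (Φ.symm s)
    exact D.toDual_C_smul c' x _ k (by rw [← map_nsmul, hk, map_zero])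

include hθ hc hCV hη in
/-- **(D5⁺) THE PLUS DUAL TRANSPORT: `X⁺_W(ℚ_∞)` IS `X⁺(V/K₀ℚ_∞)^η`** (for the purposes of every
reading): every Pontryagin-dual datum `D : StrictSignedSelmerDualData W κ E γ 1` of `Sel⁺(W/ℚ_∞)`
yields an `η`-signed PLUS dual datum of `V` over `K₀ℚ_∞` at any `γ' ∈ Gal(ℚ̄/K₀)` with
`γ⁻¹γ' ∈ ker κ`, with the same finiteness, torsion, characteristic ideal and finite submodules.
(D3⁺) `map_h1TransportInfty_strictSignedSelmerInfty_one` discharges the dictionary hypothesis.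
[cite: Kobayashi2003, Def. 2.1 (p. 5), §3 p. 5, §4 p. 8 (X⁺(E/K_∞)^η)] [cite: GreenbergLNM1716, §1 (p. 60)] -/
theorem exists_etaSignedSelmerDualData_one
    (hD : ∀ g : absoluteGaloisGroup ℚ, ∃ τ : absoluteGaloisGroup E,
      (resGalOfEmb (closureEmb (K := ℚ) E) τ)⁻¹ * g ∈ towerTopSubgroup κ K₀)
    (hκ₀ : ∀ x, ∃ g ∈ galRange (K := ℚ) K₀, κ g = x)
    (hcop : (galRange (K := ℚ) K₀).index.Coprime p)
    {γ γ' : absoluteGaloisGroup ℚ} (hγ' : γ' ∈ galRange (K := ℚ) K₀)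
    (hγγ' : γ⁻¹ * γ' ∈ κ.kerSubgroup) (D : StrictSignedSelmerDualData W κ E γ 1) :
    ∃ D' : EtaSignedSelmerDualData V κ K₀ E η γ' 1,
      (Module.Finite (IwasawaAlgebra p) D'.X ↔ Module.Finite (IwasawaAlgebra p) D.X) ∧
      (Module.IsTorsion (IwasawaAlgebra p) D'.X ↔ Module.IsTorsion (IwasawaAlgebra p) D.X) ∧
      D'.charIdeal = D.charIdeal ∧
      ((∀ M : Submodule (IwasawaAlgebra p) D'.X, Finite M → M = ⊥) ↔
        (∀ M : Submodule (IwasawaAlgebra p) D.X, Finite M → M = ⊥)) :=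
  exists_etaSignedSelmerDualData_of_map_eq W K₀ hθ hc p κ hCV η hη E 1 hcop
    (map_h1TransportInfty_strictSignedSelmerInfty_one W K₀ hθ hc p κ hCV E η hη hD hκ₀ hcop) hγ' hγγ' D

end Summit.BirchSwinnertonDyer.Rank1Residual.Additive.SignedTwist

end
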